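import Literature.NumberTheory.Automorphic.MatrixAdeleHaarChar
import Literature.NumberTheory.Automorphic.IdeleModuleProofs
import Literature.NumberTheory.Automorphic.GJUnfoldingIntegral
import HarnessLib

/-!
# The module of `X ↦ g X` and `X ↦ X g` on `M_n(𝔸_K)` is `|det g|_𝔸ⁿ`
(Weil, *Basic Number Theory* (1967), Ch. IV §3 Prop. 3 and Cor. 1; Godement–Jacquet, LNM 260
(1972), §11–§12: the factor `|det x|^{-n} |det y|^{n}` of the Poisson summation for
`ξ ↦ Φ(x ξ y⁻¹)` on `M_n(𝔸_K)`)

Topic `NumberTheory/Automorphic`; a proof file (theorems only). A brick of the discharge of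
`GodementJacquet1972_gjZeta_meromorphic` (`GodementJacquetZetaIntegrals`): the change of variables
`X ↦ A X B` in the Fourier transform on `M_n(𝔸_K)` scales additive Haar measure by
`|det A|_𝔸ⁿ |det B|_𝔸ⁿ`. The tree already proves that left and right multiplication have the same
module (`MatrixAdeleHaarChar.distribHaarChar_matrix_adele_eq_op`, by the Iwasawa decomposition:
rational, unitriangular and compact elements have module `1`, diagonal ones are treated through the
entries) and that the module of an idele on `𝔸_K` is its idelic norm
(`IdeleModuleProofs`, Tate's Lemma 4.1.2). This file computes the VALUE:

* `distribHaarChar_pi_units` — **modules multiply on finite products**: for a unit `D` of a finite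
  product `∏_i B_i` of locally compact second countable topological rings,
  `Δ_{∏ B_i}(D) = ∏_i Δ_{B_i}(D_i)` (Haar measure on the product is a multiple of the product of
  Haar measures; evaluate on a box of positive compacts);
* `adelicAbsDet_eq_one_of_mem_standardMaximalCompactGL`, `adelicAbsDet_eq_one_of_mem_upperUnitriangular`,
  `adelicAbsDet_glDiagonal` — `|det|_𝔸` on the three Iwasawa factors;
* `distribHaarChar_matrix_glDiagonal` — `Δ(diag d) = ∏_i ‖d_i‖ⁿ`;
* `distribHaarChar_matrix_adele_eq_adelicAbsDet_pow` — **`Δ(X ↦ g X) = |det g|_𝔸ⁿ`**, and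
  `distribHaarChar_matrix_adele_op_eq_adelicAbsDet_pow` — **`Δ(X ↦ X g) = |det g|_𝔸ⁿ`**;
* the measure forms `addHaar_matrix_smul_eq`, `addHaar_matrix_op_smul_eq`
  (`μ(g • Z) = |det g|ⁿ μ(Z)`, `μ(Z g) = |det g|ⁿ μ(Z)` for every additive Haar measure `μ`).

Local compactness of `𝔸_K` and of `M_n(𝔸_K)` enter as instance hypotheses, as in the two parent
files (both hold: `locallyCompactSpace_adeleRing'`).

## References

* A. Weil, *Basic Number Theory* (1967), Ch. I §2 (modules), Ch. IV §3 Prop. 3 and Cor. 1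
  [WeilBNT1967].
* R. Godement, H. Jacquet, *Zeta functions of simple algebras*, LNM 260 (1972), §11
  [GodementJacquet1972].
-/

noncomputable section

open MeasureTheory MeasureTheory.Measure Set IsDedekindDomain NumberField
open scoped ENNReal NNReal Pointwise MatrixGroups

namespace Literature.NumberTheory.Automorphic

/-! ### Modules multiply on finite products -/

section Pi

variable {ι : Type*} [Fintype ι] {B : ι → Type*} [∀ i, Ring (B i)] [∀ i, TopologicalSpace (B i)]
  [∀ i, IsTopologicalRing (B i)] [∀ i, LocallyCompactSpace (B i)] [∀ i, SecondCountableTopology (B i)]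

omit [Fintype ι] [∀ i, TopologicalSpace (B i)] [∀ i, IsTopologicalRing (B i)]
  [∀ i, LocallyCompactSpace (B i)] [∀ i, SecondCountableTopology (B i)] in
/-- A unit of the product ring moves a box to the box of the componentwise translates. [folklore] -/
theorem units_smul_pi_univ (D : (Π i, B i)ˣ) (S : ∀ i, Set (B i)) :
    D • Set.pi Set.univ S = Set.pi Set.univ fun i => MulEquiv.piUnits D i • S i := by
  ext y
  simp only [Set.mem_smul_set, Set.mem_pi, Set.mem_univ, true_implies]
  constructor
  · rintro ⟨x, hx, rfl⟩ i
    exact ⟨x i, hx i, rfl⟩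
  · intro h
    choose x hx hxy using h
    refine ⟨x, hx, funext fun i => ?_⟩
    rw [← hxy i]
    rfl

/-- **The module of a unit of a finite product of locally compact rings is the product of the
modules of its components**: `Δ_{∏ B_i}(D) = ∏_i Δ_{B_i}(D_i)` (Weil, BNT Ch. I §2: modules of
product automorphisms; evaluate both sides on a box of positive compacts, Haar measure on the
product being a multiple of the product measure). [folklore] -/
theorem distribHaarChar_pi_units (D : (Π i, B i)ˣ) :
    distribHaarChar (Π i, B i) D = ∏ i, distribHaarChar (B i) (MulEquiv.piUnits D i) := by
  letI : ∀ i, MeasurableSpace (B i) := fun i => borel (B i)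
  haveI : ∀ i, BorelSpace (B i) := fun i => ⟨rfl⟩
  haveI : BorelSpace (Π i, B i) := Pi.borelSpace
  -- Haar measures on the factors and their product
  set μ : ∀ i, Measure (B i) := fun i => addHaar with hμ
  set π : Measure (Π i, B i) := Measure.pi μ with hπ
  haveI : π.IsAddHaarMeasure := by rw [hπ]; infer_instance
  -- a regular Haar measure on the product and its comparison with `π`
  set ν : Measure (Π i, B i) := addHaar with hν
  set c : ℝ≥0 := ν.addHaarScalarFactor π with hc
  have hνπ : ν = c • π := isAddLeftInvariant_eq_smul ν π
  have hc0 : c ≠ 0 := (addHaarScalarFactor_pos_of_isAddHaarMeasure ν π).ne'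
  -- a box of positive compacts
  set S : ∀ i, TopologicalSpace.PositiveCompacts (B i) := fun i => Classical.arbitrary _ with hS
  set s : Set (Π i, B i) := Set.pi Set.univ fun i => (S i : Set (B i)) with hs
  have hSpos : ∀ i, μ i (S i) ≠ 0 := fun i h0 =>
    (isOpen_interior.measure_ne_zero (μ i) (S i).interior_nonempty)
      (measure_mono_null interior_subset h0)
  have hSfin : ∀ i, μ i (S i) ≠ ∞ := fun i => (S i).isCompact.measure_lt_top.ne
  have hπs : π s = ∏ i, μ i (S i) := by rw [hs, hπ, Measure.pi_pi]
  have hνs0 : ν s ≠ 0 := by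
    rw [hνπ, Measure.coe_nnreal_smul_apply, hπs]
    exact mul_ne_zero (by exact_mod_cast hc0) (Finset.prod_ne_zero_iff.2 fun i _ => hSpos i)
  have hνsfin : ν s ≠ ∞ := by
    rw [hνπ, Measure.coe_nnreal_smul_apply, hπs]
    exact ENNReal.mul_ne_top ENNReal.coe_ne_top (ENNReal.prod_ne_top fun i _ => hSfin i)
  refine distribHaarChar_eq_of_measure_smul_eq_mul hνs0 hνsfin ?_
  rw [hνπ, Measure.coe_nnreal_smul_apply, Measure.coe_nnreal_smul_apply, hs, units_smul_pi_univ,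
    hπ, Measure.pi_pi, Measure.pi_pi]
  simp_rw [← distribHaarChar_mul (μ _)]
  rw [Finset.prod_mul_distrib]
  push_cast
  ring

end Pi

/-! ### `|det|_𝔸` on the Iwasawa factors -/

section Det

variable (n : ℕ) (K : Type) [Field K] [NumberField K]

/-- `|det k|_𝔸 = 1` on the maximal compact `K_max = K_∞ GL_n(𝒪̂_K)` (a continuous homomorphism to
`ℝ_{>0}` is bounded on a compact subgroup, hence trivial there). [folklore] -/
theorem adelicAbsDet_eq_one_of_mem_standardMaximalCompactGL {k : GL (Fin n) (AdeleRing (𝓞 K) K)}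
    (hk : k ∈ standardMaximalCompactGL n K) : adelicAbsDet n K k = 1 := by
  have hc : Continuous (adelicAbsDet n K) :=
    continuous_induced_rng.2 (continuous_adelicAbsDet (n := n) (K := K))
  have hpos : ∀ g, 0 < adelicAbsDet n K g := fun g => by
    have := adelicAbsDet_pos (n := n) (K := K) g
    exact_mod_cast this
  exact MonoidHom.apply_eq_one_of_bddAbove (adelicAbsDet n K) hpos (standardMaximalCompactGL n K)
    (((isCompact_standardMaximalCompactGL n K).image hc).bddAbove) hk

/-- `|det u|_𝔸 = 1` for unitriangular `u` (`det u = 1`). [folklore] -/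
theorem adelicAbsDet_eq_one_of_mem_upperUnitriangular {u : GL (Fin n) (AdeleRing (𝓞 K) K)}
    (hu : u ∈ upperUnitriangular (Fin n) (AdeleRing (𝓞 K) K)) : adelicAbsDet n K u = 1 := by
  obtain ⟨hT, hdiag⟩ := (mem_upperUnitriangular_iff u).1 hu
  have hdet : Matrix.GeneralLinearGroup.det u = 1 := by
    refine Units.ext ?_
    rw [Matrix.GeneralLinearGroup.val_det_apply, Matrix.det_of_upperTriangular hT, Units.val_one]
    exact Finset.prod_eq_one fun i _ => hdiag i
  rw [adelicAbsDet_apply, hdet, map_one]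

/-- `|det diag(d)|_𝔸 = ∏_i ‖d_i‖`. [folklore] -/
theorem adelicAbsDet_glDiagonal (d : Fin n → (AdeleRing (𝓞 K) K)ˣ) :
    adelicAbsDet n K (glDiagonal n _ d) = ∏ i, IdeleClassGroup.ideleNorm K (d i) := by
  have hdet : Matrix.GeneralLinearGroup.det (glDiagonal n _ d) = ∏ i, d i := by
    refine Units.ext ?_
    rw [Matrix.GeneralLinearGroup.val_det_apply, coe_glDiagonal, Matrix.det_diagonal,
      Units.coe_prod]
  rw [adelicAbsDet_apply, hdet, map_prod]

end Det

/-! ### The value of the module -/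

section Module

variable (n : ℕ) (K : Type) [Field K] [NumberField K]
  [LocallyCompactSpace (AdeleRing (𝓞 K) K)]
  [LocallyCompactSpace (Matrix (Fin n) (Fin n) (AdeleRing (𝓞 K) K))]

/-- **`Δ(diag d) = ∏_i ‖d_i‖ⁿ` on `M_n(𝔸_K)`**: on the entries, `X ↦ diag(d) X` multiplies row `i`
by `d_i`, i.e. it is the unit `(d_i)_{i j}` of the product ring `𝔸_K^{n × n}`, whose module is
`∏_{i,j} Δ_{𝔸_K}(d_i) = ∏_i ‖d_i‖ⁿ` (`distribHaarChar_pi_units` twice and Tate's Lemma 4.1.2,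
`AdeleRing.distribHaarChar_eq_ideleNorm`). [folklore] -/
theorem distribHaarChar_matrix_glDiagonal (d : Fin n → (AdeleRing (𝓞 K) K)ˣ) :
    distribHaarChar (Matrix (Fin n) (Fin n) (AdeleRing (𝓞 K) K)) (glDiagonal n _ d) =
      ∏ i, IdeleClassGroup.ideleNorm K (d i) ^ n := by
  haveI := secondCountableTopology_adeleRing K
  -- the unit `(i, j) ↦ dᵢ` of the product ring
  set D : (Fin n → Fin n → AdeleRing (𝓞 K) K)ˣ :=
    ⟨fun i _ => (d i : AdeleRing (𝓞 K) K), fun i _ => ((d i)⁻¹ : (AdeleRing (𝓞 K) K)ˣ),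
      funext fun i => funext fun _ => (d i).mul_inv,
      funext fun i => funext fun _ => (d i).inv_mul⟩ with hD
  -- entries: `X ↦ (X i j)_{i j}`
  set er : Matrix (Fin n) (Fin n) (AdeleRing (𝓞 K) K) ≃ₜ+ (Fin n → Fin n → AdeleRing (𝓞 K) K) :=
    { toFun := fun x i j => x i j
      invFun := fun f => Matrix.of f
      left_inv := fun _ => rfl
      right_inv := fun _ => rfl
      map_add' := fun _ _ => rfl
      continuous_toFun := continuous_pi fun i => continuous_pi fun j =>
        continuous_id.matrix_elem i j
      continuous_invFun := continuous_matrix fun i j => continuous_apply_apply i j } with her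
  have h1 : distribHaarChar (Matrix (Fin n) (Fin n) (AdeleRing (𝓞 K) K)) (glDiagonal n _ d) =
      distribHaarChar (Fin n → Fin n → AdeleRing (𝓞 K) K) D := by
    refine distribHaarChar_eq_of_continuousAddEquiv er _ _ fun x => ?_
    funext i j
    change ((glDiagonal n _ d : Matrix (Fin n) (Fin n) (AdeleRing (𝓞 K) K)) * x) i j =
      (d i : AdeleRing (𝓞 K) K) * x i j
    rw [coe_glDiagonal, Matrix.diagonal_mul]
  have hDij : ∀ i j, MulEquiv.piUnits (MulEquiv.piUnits D i) j = d i := fun i j => Units.ext rfl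
  rw [h1, distribHaarChar_pi_units]
  refine Finset.prod_congr rfl fun i _ => ?_
  rw [distribHaarChar_pi_units]
  simp_rw [hDij]
  rw [Finset.prod_const, Finset.card_univ, Fintype.card_fin, AdeleRing.distribHaarChar_eq_ideleNorm]

/-- **The module of `X ↦ g X` on `M_n(𝔸_K)` is `|det g|_𝔸ⁿ`** (Weil, BNT Ch. IV §3 Prop. 3 and
Cor. 1; Godement–Jacquet (1972), §11). Proof: Iwasawa `g = diag(d) u k`
(`iwasawaDecomposition_gl_adelic_holds`, `exists_glDiagonal_mul_unitriangular`): `u` and `k` have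
module `1` and `|det| = 1`, and `Δ(diag d) = ∏ ‖d_i‖ⁿ = |det diag(d)|ⁿ`.
[cite: WeilBNT1967, Ch. IV §3 Prop. 3 and Cor. 1] -/
theorem distribHaarChar_matrix_adele_eq_adelicAbsDet_pow (g : GL (Fin n) (AdeleRing (𝓞 K) K)) :
    distribHaarChar (Matrix (Fin n) (Fin n) (AdeleRing (𝓞 K) K)) g = adelicAbsDet n K g ^ n := by
  have hIw : (standardParabolicGL (AdeleRing (𝓞 K) K) (id : Fin n → Fin n) :
      Set (GL (Fin n) (AdeleRing (𝓞 K) K))) *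
      (standardMaximalCompactGL n K : Set (GL (Fin n) (AdeleRing (𝓞 K) K))) = Set.univ :=
    iwasawaDecomposition_gl_adelic_holds n K
  have hg : g ∈ (standardParabolicGL (AdeleRing (𝓞 K) K) (id : Fin n → Fin n) :
      Set (GL (Fin n) (AdeleRing (𝓞 K) K))) *
      (standardMaximalCompactGL n K : Set (GL (Fin n) (AdeleRing (𝓞 K) K))) := by
    rw [hIw]; exact Set.mem_univ g
  obtain ⟨b, hb, k, hk, rfl⟩ := Set.mem_mul.1 hg
  obtain ⟨d, u, hu, rfl⟩ := exists_glDiagonal_mul_unitriangular n K hb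
  rw [map_mul, map_mul, distribHaarChar_matrix_maximalCompact n K hk,
    distribHaarChar_matrix_unitriangular n K hu, distribHaarChar_matrix_glDiagonal n K d,
    map_mul, map_mul, adelicAbsDet_eq_one_of_mem_standardMaximalCompactGL n K hk,
    adelicAbsDet_eq_one_of_mem_upperUnitriangular n K hu, adelicAbsDet_glDiagonal]
  simp only [mul_one, Finset.prod_pow]

/-- **The module of `X ↦ X g` on `M_n(𝔸_K)` is `|det g|_𝔸ⁿ`**
(`distribHaarChar_matrix_adele_eq_op` of `MatrixAdeleHaarChar`).
[cite: WeilBNT1967, Ch. IV §3 Prop. 3 and Cor. 1] -/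
theorem distribHaarChar_matrix_adele_op_eq_adelicAbsDet_pow (g : GL (Fin n) (AdeleRing (𝓞 K) K)) :
    distribHaarChar (Matrix (Fin n) (Fin n) (AdeleRing (𝓞 K) K))
        (Units.opEquiv.symm (MulOpposite.op g)) = adelicAbsDet n K g ^ n := by
  rw [← distribHaarChar_matrix_adele_eq_op, distribHaarChar_matrix_adele_eq_adelicAbsDet_pow]

variable [MeasurableSpace (Matrix (Fin n) (Fin n) (AdeleRing (𝓞 K) K))]
  [BorelSpace (Matrix (Fin n) (Fin n) (AdeleRing (𝓞 K) K))]
  (μ : Measure (Matrix (Fin n) (Fin n) (AdeleRing (𝓞 K) K))) [μ.IsAddHaarMeasure] [μ.Regular]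

/-- **`vol(g Z) = |det g|_𝔸ⁿ vol(Z)`** for every additive Haar measure on `M_n(𝔸_K)`.
[cite: WeilBNT1967, Ch. IV §3 Cor. 1] -/
theorem addHaar_matrix_smul_eq (g : GL (Fin n) (AdeleRing (𝓞 K) K))
    (Z : Set (Matrix (Fin n) (Fin n) (AdeleRing (𝓞 K) K))) :
    μ (g • Z) = ((adelicAbsDet n K g ^ n : ℝ≥0) : ℝ≥0∞) * μ Z := by
  rw [← distribHaarChar_mul μ g Z, distribHaarChar_matrix_adele_eq_adelicAbsDet_pow]

/-- **`vol(Z g) = |det g|_𝔸ⁿ vol(Z)`** for every additive Haar measure on `M_n(𝔸_K)` (the right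
translate `Z g` written as the action of the opposite unit). [cite: WeilBNT1967, Ch. IV §3 Cor. 1] -/
theorem addHaar_matrix_op_smul_eq (g : GL (Fin n) (AdeleRing (𝓞 K) K))
    (Z : Set (Matrix (Fin n) (Fin n) (AdeleRing (𝓞 K) K))) :
    μ (Units.opEquiv.symm (MulOpposite.op g) • Z) = ((adelicAbsDet n K g ^ n : ℝ≥0) : ℝ≥0∞) * μ Z := by
  rw [← distribHaarChar_mul μ _ Z, distribHaarChar_matrix_adele_op_eq_adelicAbsDet_pow]

end Module

end Literature.NumberTheory.Automorphic
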